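import Summits.PneNP.PneNP.Theses.PlantedClique
import Literature.Probability.RandomGraphs.PlantedCliqueProgramFP
import Literature.Probability.RandomGraphs.PlantedCliqueProgramMatrix
import Literature.Probability.RandomGraphs.PlantedCliqueRecovery
import Literature.Computability.Complexity.CodeFPBudgets
import Literature.Computability.Complexity.CodeFPStrings
import Literature.Computability.Complexity.UnaryBricks
import Literature.Computability.Complexity.RandomizedProofs
import Literature.Computability.Complexity.TimeBoundsProofs
import Literature.Computability.Complexity.StringEquality

/-!
# Route PlantedClique — `PlantedcliqueRecoveryGlue`, part 1: the clique-checking test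
(helper for stmt-PneNP-8689)

"A recovery algorithm plus a clique check is a test": for a PPT recovery algorithm `A` the test
`T(1ⁿ, G; r) := [decodeVertexSet n (A(1ⁿ, G; r)) is a clique of G of size ≥ t(n)]`, `t(n) = (⌊log₂ n⌋ + 2)²`,
is PPT (one typed `CodeFP` program for the check — unary size, edge string, output bits — composed with
`A`'s machine through the pair presentation). This file provides the check with its semantics and the
`IsPolyTime` transport.
-/

set_option linter.dupNamespace false -- `Summit.PneNP.PneNP.…`: summit = sub-problem name (D-0017 single-conjunct layout)

namespace Summit.PneNP.PneNP.Theorems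

open _root_.Computability Finset
open Literature.Computability.Complexity Literature.Computability.Complexity.CodeFP
  Literature.Computability.Complexity.Brick
open Literature.Probability.RandomGraphs Literature.Probability.RandomGraphs.PlantedClique
  Literature.Probability.RandomGraphs.PlantedClique.AKSProg

/-- The decoded vertex list `[i < n | o[i] = 1]` has the cardinality of `decodeVertexSet n o` as its
length. [folklore] -/
theorem recoveryGlue_length_filter_range (n : ℕ) (o : List Bool) :
    ((List.range n).filter fun i => o.getD i false).length = (decodeVertexSet n o).card := by
  rw [length_filter_eq_card (List.range n) (List.nodup_range) (fun b hb => List.mem_range.1 hb)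
    (fun i => o.getD i false) (fun a : Fin n => o.getD a false = true) (fun _ _ => Iff.rfl)]
  congr 1
  ext a
  simp [decodeVertexSet, List.mem_range]

/-- The list-level clique test on the decoded vertex list is the clique property of the decoded set.
[folklore] -/
theorem recoveryGlue_isClique_iff {n : ℕ} (x : EdgeVec n) (o : List Bool) :
    isClique n (encodeEdgeVec x) ((List.range n).filter fun i => o.getD i false) = true ↔
      (graphOfEdgeVec x).IsClique (decodeVertexSet n o : Set (Fin n)) := by
  rw [isClique_eq_true_iff]
  simp only [List.mem_filter, List.mem_range]
  constructor
  · intro h u hu v hv huv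
    have hu' : o.getD u false = true := by simpa [decodeVertexSet] using hu
    have hv' : o.getD v false = true := by simpa [decodeVertexSet] using hv
    rcases h u ⟨u.isLt, hu'⟩ v ⟨v.isLt, hv'⟩ with h1 | h1
    · exact absurd (Fin.ext h1) huv
    · exact (adj_encodeEdgeVec x u v).1 h1
  · rintro h a ⟨ha, hao⟩ b ⟨hb, hbo⟩
    by_cases hab : a = b
    · exact Or.inl hab
    · right
      have ha' : (⟨a, ha⟩ : Fin n) ∈ (decodeVertexSet n o : Set (Fin n)) := by
        simpa [decodeVertexSet] using hao
      have hb' : (⟨b, hb⟩ : Fin n) ∈ (decodeVertexSet n o : Set (Fin n)) := by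
        simpa [decodeVertexSet] using hbo
      exact (adj_encodeEdgeVec_nat x ha hb).2 (h ha' hb' (fun h' => hab (Fin.mk.inj_iff.1 h')))

/-- **The clique check as a typed program**, with its semantics on genuine inputs
`(⟨1ⁿ, enc G⟩, o)`: it accepts iff `decodeVertexSet n o` is a clique of `G` of size `≥ (⌊log₂ n⌋ + 2)²`.
[cite: BarakHopkinsKelnerKothariMoitraPotechin2019, Rem. 1.2] [folklore] -/
theorem recoveryGlue_exists_check :
    ∃ τ : List Bool × List Bool → Bool, CodeFP (pairE strE strE) bitE τ ∧
      ∀ (n : ℕ) (x : EdgeVec n) (o : List Bool),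
        τ (boolPair (unaryEncodeNat n) (encodeEdgeVec x), o) = true ↔
          (Nat.log 2 n + 2) ^ 2 ≤ (decodeVertexSet n o).card ∧
            (graphOfEdgeVec x).IsClique (decodeVertexSet n o : Set (Fin n)) := by
  have hf : CodeFP strE strE fstF := CodeFP.of_fn fstF fstF_mem_FP fun _ => rfl
  have hs : CodeFP strE strE sndF := CodeFP.of_fn sndF sndF_mem_FP fun _ => rfl
  have hlogU : CodeFP unE unE fun m : ℕ => Nat.log 2 m :=
    CodeFP.of_fn logFn logFn_mem_FP fun m => by rw [logFn, length_unE, unE_eq_ones]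
  have qw : CodeFP (pairE strE strE) strE fun q : List Bool × List Bool => q.1 := CodeFP.fst _ _
  have qo : CodeFP (pairE strE strE) strE fun q : List Bool × List Bool => q.2 := CodeFP.snd _ _
  have qnU : CodeFP (pairE strE strE) unE fun q : List Bool × List Bool => (fstF q.1).length :=
    (strLength.comp (hf.comp qw) :)
  have qnN : CodeFP (pairE strE strE) natE fun q : List Bool × List Bool => (fstF q.1).length :=
    (natOfUn.comp qnU :)
  have qx : CodeFP (pairE strE strE) strE fun q : List Bool × List Bool => sndF q.1 := (hs.comp qw :)
  have qlogN : CodeFP (pairE strE strE) natE fun q : List Bool × List Bool => Nat.log 2 (fstF q.1).length :=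
    (natOfUn.comp (hlogU.comp qnU) :)
  have qt1 : CodeFP (pairE strE strE) natE fun q : List Bool × List Bool => Nat.log 2 (fstF q.1).length + 2 :=
    (natAdd.comp (qlogN.pair (CodeFP.const _ 2)) :)
  have qt : CodeFP (pairE strE strE) natE fun q : List Bool × List Bool =>
      (Nat.log 2 (fstF q.1).length + 2) * (Nat.log 2 (fstF q.1).length + 2) := (natMul.comp (qt1.pair qt1) :)
  have hp : CodeFP (pairE strE natE) bitE fun c : List Bool × ℕ => c.1.getD c.2 false := strGetDNat
  have qR : CodeFP (pairE strE strE) (rawE natE) fun q : List Bool × List Bool =>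
      List.range (min (fstF q.1).length (fstF q.1).length) := (rangeOf.comp (qnU.pair qnN) :)
  have qC : CodeFP (pairE strE strE) (rawE natE) fun q : List Bool × List Bool =>
      (List.range (min (fstF q.1).length (fstF q.1).length)).filter fun i => q.2.getD i false :=
    ((CodeFP.filter hp).comp (qo.pair qR) :)
  have qlen : CodeFP (pairE strE strE) natE fun q : List Bool × List Bool =>
      ((List.range (min (fstF q.1).length (fstF q.1).length)).filter fun i => q.2.getD i false).length :=
    ((natLength natE).comp qC :)
  have qge : CodeFP (pairE strE strE) bitE fun q : List Bool × List Bool =>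
      decide ((Nat.log 2 (fstF q.1).length + 2) * (Nat.log 2 (fstF q.1).length + 2) ≤
        ((List.range (min (fstF q.1).length (fstF q.1).length)).filter fun i => q.2.getD i false).length) :=
    (natLe.comp (qt.pair qlen) :)
  have qclq : CodeFP (pairE strE strE) bitE fun q : List Bool × List Bool =>
      isClique (fstF q.1).length (sndF q.1)
        ((List.range (min (fstF q.1).length (fstF q.1).length)).filter fun i => q.2.getD i false) :=
    (isClique_codeFP.comp ((qnU.pair qx).pair qC) :)
  refine ⟨_, qge.and qclq, fun n x o => ?_⟩
  simp only [Bool.and_eq_true, decide_eq_true_eq, fstF_boolPair, sndF_boolPair, min_self]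
  rw [show (unaryEncodeNat n).length = n from length_unE n, recoveryGlue_length_filter_range,
    recoveryGlue_isClique_iff, ← sq]

/-- **The test is PPT**: composing the check with `A`'s machine through the pair presentation
(`⟨w, r⟩ ↦ ⟨w, A(w; r)⟩ ↦ check`). [cite: AroraBarak2009, §7.1] [folklore] -/
theorem recoveryGlue_test_isPolyTime {A : RandAlg (List Bool) (List Bool)} (hA : A.IsPolyTime id id)
    {τ : List Bool × List Bool → Bool} (hτ : CodeFP (pairE strE strE) bitE τ) :
    (RandAlg.mk (fun w r => τ (w, A.run w r)) A.coinLen).IsPolyTime id (fun b => [b]) := by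
  obtain ⟨fτ, hfτ, hfτs⟩ := hτ
  -- `A`'s machine as a string function `z ↦ A (fst z) (snd z)`
  have hdec : PolyTimeComputable (id : List Bool → List Bool)
      (fun p : List Bool × List Bool => boolPair (id p.1) p.2) (fun z : List Bool => (fstF z, sndF z)) := by
    obtain ⟨p, M, hM⟩ := fanoutFn_mem_FP fstF_mem_FP sndF_mem_FP
    refine ⟨p, M, fun z => ?_⟩
    have h := hM z
    simp only [id, fanoutFn_apply] at h ⊢
    exact h
  have hgA : (fun z : List Bool => A.run (fstF z) (sndF z)) ∈ FP := by
    obtain ⟨p, M, hM⟩ := PolyTimeComputable.comp_holds hA.1 hdec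
    exact ⟨p, M, fun z => hM z⟩
  have hF : fτ ∘ fanoutFn fstF (fun z : List Bool => A.run (fstF z) (sndF z)) ∈ FP :=
    comp_mem_FP hfτ (fanoutFn_mem_FP fstF_mem_FP hgA)
  have hrun : ∀ w r : List Bool, [τ (w, A.run w r)] =
      (fτ ∘ fanoutFn fstF (fun z : List Bool => A.run (fstF z) (sndF z))) (boolPair w r) := by
    intro w r
    rw [Function.comp_apply, fanoutFn_apply, fstF_boolPair, sndF_boolPair]
    exact (hfτs (w, A.run w r)).symm
  refine ⟨?_, hA.2⟩
  exact PolyTimeComputable.of_encode_eq (ea := id) (eb := id)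
    (f := fτ ∘ fanoutFn fstF (fun z : List Bool => A.run (fstF z) (sndF z)))
    (fun p : List Bool × List Bool => boolPair p.1 p.2) (fun _ => rfl) (fun p => (hrun p.1 p.2).symm) hF

end Summit.PneNP.PneNP.Theorems
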